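import Literature.Algebra.Lie.SelfAdjointHullPolar
import Literature.MathematicalPhysics.QuantumLattice.HubbardNNNHoppingFlux
import Literature.MathematicalPhysics.QuantumLattice.HubbardGaugeBound
import Literature.MathematicalPhysics.QuantumLattice.FermionLiebRobinson
import Summits.HubbardSuperconductivity.HubbardSuperconductivity.Theorems.WeakCouplingBCSWcbcsBcsConstructionHamiltonianNormBound
import Mathlib
import HarnessLib

/-!
# Sector partition functions of the seam-flux `t–t′` Hubbard torus at complex temperature: a-priori bounds

Helper module for route `TcThermcert1`, crux K1 `ThermalStiffnessCeilingU8b10_le_1o8` (item `stmt-Ventures-26381`), line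
`Cruxes/ThermalStiffnessCeilingU8b10_le_1o8/Lines/zerofree_corridor.lean`: the ingredients of its stub `stub_corridorData`
(everything about the corridor data of `β ↦ Z_L(β, θ) = tr_sector e^{−β H_L(θ)}` EXCEPT zero-freeness):

* §1 (any finite Hermitian `H`, complex `z`): `tr e^{−zH} = Σ_i e^{−z λ_i}` is entire, `|tr e^{−zH}| ≤ |n| e^{|Re z| Λ}`, and on
  the real axis it is real with `Re tr e^{−xH} ≥ |n| e^{−|x| Λ}`, whenever `|λ_i| ≤ Λ`; `‖M.toBlock p p‖ ≤ ‖M‖` (so, with the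
  tree's `abs_eigenvalues_le_norm`, block eigenvalues are `≤ ‖M‖`).
* §2 (the model): `‖H_L(θ)‖ ≤ (18 + 10|U| + 26|t′|)·L²` for the seam-flux Hamiltonian `hubbardTorusTT'Flux L t′ U θ`, uniformly in
  the flux `θ` (term-by-term: `≤ 5L²` Hubbard terms of norm `≤ 2 + |U|`, `≤ 5L²` diagonal-hopping terms of norm `≤ 2|t′|`, the two
  seam corrections of norms `≤ 8L` and `≤ 16|t′|L²`), hence every eigenvalue of every coordinate-sector block of `H_L(θ)` is
  `≤ (18 + 10|U| + 26|t′|)·L²` in absolute value; and a sector has dimension `≤ 4^{L²} ≤ e^{2L²}`.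

All statements are finite-dimensional folklore (spectral theorem; `‖c†‖, ‖c‖ ≤ 1`); no physics claim is made here — in particular
nothing about superconductivity in the Hubbard model is proved by anything in this file.
-/

namespace Summit.Ventures.CertifiedManyBodySolver.Theorems.TcThermcert1.ZeroFreeCorridor

open Matrix Finset
open scoped ComplexConjugate
open Literature.Algebra.Lie.SelfAdjointHullPolar
open Literature.MathematicalPhysics.QuantumLattice
open Literature.MathematicalPhysics.QuantumFieldTheory
open Literature.Probability.LatticeModels

/-! ## §1 Spectral sums `tr e^{−zH}` -/

section Spectral

variable {n : Type*} [Fintype n] [DecidableEq n]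

/-- `tr e^{zA} = Σ_i e^{λ_i z}` for Hermitian `A` and complex `z` (spectral theorem). -/
theorem trace_exp_smul_eq_sum_eigenvalues {A : Matrix n n ℂ} (hA : A.IsHermitian) (z : ℂ) :
    (NormedSpace.exp (z • A)).trace = ∑ i, Complex.exp ((hA.eigenvalues i : ℂ) * z) := by
  conv_lhs => rw [eq_conj_diagonal_of_isHermitian hA]
  rw [exp_smul_conj_diagonal, trace_mul_cycle, Matrix.mem_unitaryGroup_iff'.mp hA.eigenvectorUnitary.2, one_mul,
    trace_diagonal]

/-- The complex-temperature partition function as a spectral sum: `tr e^{−zH} = Σ_i e^{−z λ_i}`. -/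
theorem trace_exp_neg_smul_eq_sum_eigenvalues {H : Matrix n n ℂ} (hH : H.IsHermitian) (z : ℂ) :
    (NormedSpace.exp (-z • H)).trace = ∑ i, Complex.exp (-(z * hH.eigenvalues i)) := by
  rw [trace_exp_smul_eq_sum_eigenvalues hH]
  refine Finset.sum_congr rfl fun i _ => ?_
  ring_nf

/-- `z ↦ tr e^{−zH}` is entire. -/
theorem differentiable_trace_exp_neg_smul {H : Matrix n n ℂ} (hH : H.IsHermitian) :
    Differentiable ℂ fun z : ℂ => (NormedSpace.exp (-z • H)).trace := by
  have h : (fun z : ℂ => (NormedSpace.exp (-z • H)).trace) = fun z => ∑ i, Complex.exp (-(z * hH.eigenvalues i)) :=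
    funext fun z => trace_exp_neg_smul_eq_sum_eigenvalues hH z
  rw [h]
  fun_prop

/-- At infinite temperature the partition function is the dimension: `tr e^{−0·H} = |n|`. -/
theorem trace_exp_neg_zero_smul (H : Matrix n n ℂ) :
    (NormedSpace.exp (-(0 : ℂ) • H)).trace = Fintype.card n := by
  rw [neg_zero, zero_smul, NormedSpace.exp_zero, trace_one]

/-- `|tr e^{−zH}| ≤ |n| · e^{|Re z| Λ}` when all `|λ_i| ≤ Λ`. -/
theorem norm_trace_exp_neg_smul_le {H : Matrix n n ℂ} (hH : H.IsHermitian) {Λ : ℝ} (hΛ : ∀ i, |hH.eigenvalues i| ≤ Λ)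
    (z : ℂ) : ‖(NormedSpace.exp (-z • H)).trace‖ ≤ Fintype.card n * Real.exp (|z.re| * Λ) := by
  rw [trace_exp_neg_smul_eq_sum_eigenvalues hH]
  refine (norm_sum_le _ _).trans ?_
  have hterm : ∀ i, ‖Complex.exp (-(z * hH.eigenvalues i))‖ ≤ Real.exp (|z.re| * Λ) := by
    intro i
    rw [Complex.norm_exp]
    refine Real.exp_le_exp.mpr ?_
    simp only [Complex.neg_re, Complex.mul_re, Complex.ofReal_re, Complex.ofReal_im, mul_zero, sub_zero]
    calc -(z.re * hH.eigenvalues i) ≤ |z.re * hH.eigenvalues i| := neg_le_abs _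
      _ = |z.re| * |hH.eigenvalues i| := abs_mul _ _
      _ ≤ |z.re| * Λ := mul_le_mul_of_nonneg_left (hΛ i) (abs_nonneg _)
  calc ∑ i, ‖Complex.exp (-(z * hH.eigenvalues i))‖ ≤ ∑ _i : n, Real.exp (|z.re| * Λ) := Finset.sum_le_sum fun i _ => hterm i
    _ = Fintype.card n * Real.exp (|z.re| * Λ) := by rw [Finset.sum_const, Finset.card_univ, nsmul_eq_mul]

/-- On the real axis `tr e^{−xH}` is real. -/
theorem trace_exp_neg_smul_ofReal_im {H : Matrix n n ℂ} (hH : H.IsHermitian) (x : ℝ) :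
    ((NormedSpace.exp (-(x : ℂ) • H)).trace).im = 0 := by
  rw [trace_exp_neg_smul_eq_sum_eigenvalues hH, Complex.im_sum]
  refine Finset.sum_eq_zero fun i _ => ?_
  rw [show -((x : ℂ) * (hH.eigenvalues i : ℂ)) = ((-(x * hH.eigenvalues i) : ℝ) : ℂ) by push_cast; ring,
    Complex.exp_ofReal_im]

/-- On the real axis `Re tr e^{−xH} ≥ |n| · e^{−|x| Λ}` when all `|λ_i| ≤ Λ` (each Boltzmann factor is at least `e^{−|x|Λ}`). -/
theorem card_mul_exp_neg_le_trace_exp_neg_smul_ofReal_re {H : Matrix n n ℂ} (hH : H.IsHermitian) {Λ : ℝ}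
    (hΛ : ∀ i, |hH.eigenvalues i| ≤ Λ) (x : ℝ) :
    Fintype.card n * Real.exp (-(|x| * Λ)) ≤ ((NormedSpace.exp (-(x : ℂ) • H)).trace).re := by
  rw [trace_exp_neg_smul_eq_sum_eigenvalues hH, Complex.re_sum]
  have hterm : ∀ i, (Complex.exp (-((x : ℂ) * hH.eigenvalues i))).re = Real.exp (-(x * hH.eigenvalues i)) := by
    intro i
    rw [show -((x : ℂ) * (hH.eigenvalues i : ℂ)) = ((-(x * hH.eigenvalues i) : ℝ) : ℂ) by push_cast; ring,
      Complex.exp_ofReal_re]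
  simp only [hterm]
  have hle : ∀ i, Real.exp (-(|x| * Λ)) ≤ Real.exp (-(x * hH.eigenvalues i)) := by
    intro i
    refine Real.exp_le_exp.mpr (neg_le_neg ?_)
    calc x * hH.eigenvalues i ≤ |x * hH.eigenvalues i| := le_abs_self _
      _ = |x| * |hH.eigenvalues i| := abs_mul _ _
      _ ≤ |x| * Λ := mul_le_mul_of_nonneg_left (hΛ i) (abs_nonneg _)
  calc (Fintype.card n : ℝ) * Real.exp (-(|x| * Λ)) = ∑ _i : n, Real.exp (-(|x| * Λ)) := by
        rw [Finset.sum_const, Finset.card_univ, nsmul_eq_mul]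
    _ ≤ ∑ i, Real.exp (-(x * hH.eigenvalues i)) := Finset.sum_le_sum fun i _ => hle i

end Spectral

/-! ## §1′ Eigenvalues versus the `ℓ²` operator norm; norms of principal blocks -/

section OpNorm

open scoped Matrix.Norms.L2Operator

variable {n : Type*} [Fintype n] [DecidableEq n]

/-- Principal blocks do not increase the `ℓ²` operator norm: `‖M.toBlock p p‖ ≤ ‖M‖` (`M.toBlock p p = P M Pᴴ` with the
coordinate co-isometry `P`, `P Pᴴ = 1`). -/
theorem l2_opNorm_toBlock_le (M : Matrix n n ℂ) (p : n → Prop) [DecidablePred p] : ‖M.toBlock p p‖ ≤ ‖M‖ := by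
  set P : Matrix {a // p a} n ℂ := (1 : Matrix n n ℂ).submatrix Subtype.val id with hP
  have hB : M.toBlock p p = P * M * Pᴴ := by
    ext s t
    simp [hP, Matrix.mul_apply, Matrix.one_apply, toBlock_apply]
  have hPP : P * Pᴴ = 1 := by
    ext s t
    simp [hP, Matrix.mul_apply, Matrix.one_apply, Subtype.val_inj]
  have h1 : ‖(1 : Matrix {a // p a} {a // p a} ℂ)‖ ≤ 1 := by
    rw [Matrix.cstar_norm_def, map_one, ContinuousLinearMap.one_def]
    exact ContinuousLinearMap.norm_id_le
  have hPn : ‖Pᴴ‖ ≤ 1 := by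
    have h := l2_opNorm_conjTranspose_mul_self Pᴴ
    rw [conjTranspose_conjTranspose, hPP] at h
    nlinarith [norm_nonneg Pᴴ, h1, h]
  have hPn' : ‖P‖ ≤ 1 := by rw [← l2_opNorm_conjTranspose]; exact hPn
  rw [hB]
  calc ‖P * M * Pᴴ‖ ≤ ‖P * M‖ * ‖Pᴴ‖ := l2_opNorm_mul _ _
    _ ≤ ‖P‖ * ‖M‖ * ‖Pᴴ‖ := mul_le_mul_of_nonneg_right (l2_opNorm_mul _ _) (norm_nonneg _)
    _ ≤ 1 * ‖M‖ * 1 := by gcongr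
    _ = ‖M‖ := by ring

/-- Eigenvalues of a principal block of a Hermitian matrix are bounded by the norm of the whole matrix: `|λ_i(B)| ≤ ‖B‖` (the
eigenvalue lies in the spectrum; cf. the tree's `abs_eigenvalues_le_norm` in `StabilitySpectralFlowProofs`, not imported here), then
`‖M.toBlock p p‖ ≤ ‖M‖`. -/
theorem abs_eigenvalues_toBlock_le_norm {M : Matrix n n ℂ} (p : n → Prop) [DecidablePred p]
    (hB : (M.toBlock p p).IsHermitian) (i : {a // p a}) : |hB.eigenvalues i| ≤ ‖M‖ := by
  haveI : Nonempty {a // p a} := ⟨i⟩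
  have hmem : ((hB.eigenvalues i : ℝ) : ℂ) ∈ spectrum ℂ (M.toBlock p p) :=
    (spectrum.algebraMap_mem_iff ℂ).mpr (hB.eigenvalues_mem_spectrum_real i)
  have h := spectrum.norm_le_norm_of_mem hmem
  rw [Complex.norm_real, Real.norm_eq_abs] at h
  exact h.trans (l2_opNorm_toBlock_le M p)

end OpNorm

/-! ## §2 The seam-flux `t–t′` torus: a flux-uniform norm bound and the sector dimensions -/

section Model

open scoped Matrix.Norms.L2Operator

variable {L : ℕ} [NeZero L]

/-- Vertices of the diagonal (next-nearest-neighbour) torus graph have at most `4` neighbours. -/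
theorem card_filter_fermionTorusDiagGraph_adj_le (v : FermionTorus 2 L) :
    (Finset.univ.filter ((fermionTorusDiagGraph L).Adj v)).card ≤ 4 := by
  classical
  have hsub : (Finset.univ.filter ((fermionTorusDiagGraph L).Adj v)).image FermionTorus.toTorusSite ⊆
      (Finset.univ : Finset (Fin 2 × Bool)).image fun p =>
        if p.2 then v.toTorusSite + torusDiagJump L p.1 else v.toTorusSite - torusDiagJump L p.1 := by
    intro z hz
    obtain ⟨w, hw, rfl⟩ := Finset.mem_image.1 hz
    have hadj := (Finset.mem_filter.1 hw).2
    simp only [fermionTorusDiagGraph, SimpleGraph.comap_adj, torusDiagGraph, SimpleGraph.fromRel_adj] at hadj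
    obtain ⟨-, ⟨s, h⟩ | ⟨s, h⟩⟩ := hadj
    · exact Finset.mem_image.2 ⟨(s, true), Finset.mem_univ _, by simp only [if_true]; exact h.symm⟩
    · refine Finset.mem_image.2 ⟨(s, false), Finset.mem_univ _, ?_⟩
      simp only [Bool.false_eq_true, if_false]
      rw [h, add_sub_cancel_right]
  have hinj : Function.Injective (FermionTorus.toTorusSite : FermionTorus 2 L → TorusSite 2 L) :=
    FermionTorus.equivTorusSite.injective
  calc (Finset.univ.filter ((fermionTorusDiagGraph L).Adj v)).card
      = ((Finset.univ.filter ((fermionTorusDiagGraph L).Adj v)).image FermionTorus.toTorusSite).card :=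
        (Finset.card_image_of_injective _ hinj).symm
    _ ≤ ((Finset.univ : Finset (Fin 2 × Bool)).image fun p =>
        if p.2 then v.toTorusSite + torusDiagJump L p.1 else v.toTorusSite - torusDiagJump L p.1).card :=
        Finset.card_le_card hsub
    _ ≤ (Finset.univ : Finset (Fin 2 × Bool)).card := Finset.card_image_le
    _ = 4 := by simp

omit [NeZero L] in
/-- `‖c†_i c_j‖ ≤ 1` on the torus Fock space. -/
theorem norm_creation_mul_annihilation_le_one (i j : Orb (FermionTorus 2 L)) :
    ‖(creation i * annihilation j : Matrix (Finset (Orb (FermionTorus 2 L))) (Finset (Orb (FermionTorus 2 L))) ℂ)‖ ≤ 1 := by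
  have h1 := norm_creation_le_one (ι := Orb (FermionTorus 2 L)) i
  have h2 := norm_annihilation_le_one (ι := Orb (FermionTorus 2 L)) j
  exact (norm_mul_le _ _).trans (mul_le_one₀ h1 (norm_nonneg _) h2)

/-- The vertical-seam twist correction has norm `≤ 8L` (`4L` terms of norm `≤ 2`). -/
theorem norm_seamTwist_le (θ : ℝ) : ‖seamTwist L θ‖ ≤ 8 * L := by
  have hph : ∀ b : Bool, ‖(1 : ℂ) - Complex.exp ((if b then 1 else -1) * Complex.I * θ)‖ ≤ 2 := by
    intro b
    refine (norm_sub_le _ _).trans ?_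
    have : ‖Complex.exp ((if b then 1 else -1) * Complex.I * θ)‖ = 1 := by
      rw [Complex.norm_exp]
      cases b <;> simp
    rw [this, norm_one]; norm_num
  calc ‖seamTwist L θ‖ ≤ ∑ _y : ZMod L, ∑ _σ : Fin 2, ∑ _b : Bool, (2 : ℝ) := by
        unfold seamTwist
        refine (norm_sum_le _ _).trans (Finset.sum_le_sum fun y _ => (norm_sum_le _ _).trans
          (Finset.sum_le_sum fun σ _ => (norm_sum_le _ _).trans (Finset.sum_le_sum fun b _ => ?_)))
        refine (norm_smul_le _ _).trans ?_
        refine (mul_le_mul (hph b) (norm_creation_mul_annihilation_le_one _ _) (norm_nonneg _) zero_le_two).trans ?_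
        norm_num
    _ = 8 * L := by
        simp only [Finset.sum_const, Finset.card_univ, ZMod.card, Fintype.card_fin, Fintype.card_bool]
        ring

/-- The diagonal-seam twist correction has norm `≤ 16L²` (`4L²` summands of norm `≤ 4`). -/
theorem norm_diagSeamTwist_le (θ : ℝ) : ‖diagSeamTwist L θ‖ ≤ 16 * (L : ℝ) ^ 2 := by
  have he1 : ‖(1 : ℂ) - ((Circle.exp θ : Circle) : ℂ)‖ ≤ 2 :=
    (norm_sub_le _ _).trans (by rw [Circle.norm_coe, norm_one]; norm_num)
  have he2 : ‖(1 : ℂ) - conj ((Circle.exp θ : Circle) : ℂ)‖ ≤ 2 := by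
    rw [← Complex.norm_conj, map_sub, map_one, Complex.conj_conj]; exact he1
  calc ‖diagSeamTwist L θ‖ ≤ ∑ _s : Fin 2, ∑ _x : Site 2 L, ∑ _σ : Fin 2, (4 : ℝ) := by
        unfold diagSeamTwist
        refine (norm_sum_le _ _).trans (Finset.sum_le_sum fun s _ => (norm_sum_le _ _).trans
          (Finset.sum_le_sum fun x _ => (norm_sum_le _ _).trans (Finset.sum_le_sum fun σ _ => ?_)))
        split_ifs
        · refine (norm_add_le _ _).trans ?_
          refine (add_le_add
            ((norm_smul_le _ _).trans (mul_le_mul he1 (norm_creation_mul_annihilation_le_one _ _) (norm_nonneg _) zero_le_two))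
            ((norm_smul_le _ _).trans (mul_le_mul he2 (norm_creation_mul_annihilation_le_one _ _) (norm_nonneg _) zero_le_two))).trans ?_
          norm_num
        · rw [norm_zero]; norm_num
    _ = 16 * (L : ℝ) ^ 2 := by
        have hcard : Fintype.card (Site 2 L) = L ^ 2 := by simp [ZMod.card, Fintype.card_fin]
        simp only [Finset.sum_const, Finset.card_univ, hcard, Fintype.card_fin]
        ring

/-- `‖H_{t=1,U}‖ ≤ 10 (1 + |U|) L²` for the nearest-neighbour torus Hubbard Hamiltonian (`≤ 5L²` local terms of norm `≤ 2 + |U|`). -/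
theorem norm_hamiltonian_fermionTorusGraph_le (U : ℝ) :
    ‖hamiltonian (fermionTorusGraph 2 L) 1 U‖ ≤ 10 * (1 + |U|) * (L : ℝ) ^ 2 := by
  have hcard : (Fintype.card (HubbardIdx (fermionTorusGraph 2 L)) : ℝ) ≤ 5 * (L : ℝ) ^ 2 := by
    exact_mod_cast Summit.HubbardSuperconductivity.HubbardSuperconductivity.Theorems.card_hubbardIdx_fermionTorus_two_le L
  rw [← hamiltonianWith_zero, ← sum_hubbardTermOp]
  calc ‖∑ Z, hubbardTermOp (fermionTorusGraph 2 L) 1 U 0 Z‖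
      ≤ ∑ Z, ‖hubbardTermOp (fermionTorusGraph 2 L) 1 U 0 Z‖ := norm_sum_le _ _
    _ ≤ ∑ _Z : HubbardIdx (fermionTorusGraph 2 L), 2 * (1 + |U|) :=
        Finset.sum_le_sum fun Z _ => (norm_hubbardTermOp_le _ 1 U 0 Z).trans (by rw [abs_one, abs_zero]; linarith [abs_nonneg U])
    _ = (Fintype.card (HubbardIdx (fermionTorusGraph 2 L)) : ℝ) * (2 * (1 + |U|)) := by
        rw [Finset.sum_const, nsmul_eq_mul, Finset.card_univ]
    _ ≤ (5 * (L : ℝ) ^ 2) * (2 * (1 + |U|)) := mul_le_mul_of_nonneg_right hcard (by positivity)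
    _ = 10 * (1 + |U|) * (L : ℝ) ^ 2 := by ring

/-- `‖H′_{t′}‖ ≤ 10 |t′| L²` for the diagonal (next-nearest-neighbour) hopping Hamiltonian. -/
theorem norm_hamiltonian_fermionTorusDiagGraph_le (t' : ℝ) :
    ‖hamiltonian (fermionTorusDiagGraph L) t' 0‖ ≤ 10 * |t'| * (L : ℝ) ^ 2 := by
  have hcard : (Fintype.card (HubbardIdx (fermionTorusDiagGraph L)) : ℝ) ≤ 5 * (L : ℝ) ^ 2 := by
    have h := Summit.HubbardSuperconductivity.HubbardSuperconductivity.Theorems.card_hubbardIdx_le_of_degree_le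
      (fermionTorusDiagGraph L) (Δ := 4) fun x => card_filter_fermionTorusDiagGraph_adj_le x
    rw [show Fintype.card (FermionTorus 2 L) = L ^ 2 from by
      change Fintype.card (Fin 2 → Fin L) = L ^ 2; rw [Fintype.card_fun, Fintype.card_fin, Fintype.card_fin]] at h
    have h' : (Fintype.card (HubbardIdx (fermionTorusDiagGraph L)) : ℝ) ≤ ((4 + 1) * L ^ 2 : ℕ) := by exact_mod_cast h
    refine h'.trans (le_of_eq ?_)
    push_cast; ring
  rw [← hamiltonianWith_zero, ← sum_hubbardTermOp]
  calc ‖∑ Z, hubbardTermOp (fermionTorusDiagGraph L) t' 0 0 Z‖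
      ≤ ∑ Z, ‖hubbardTermOp (fermionTorusDiagGraph L) t' 0 0 Z‖ := norm_sum_le _ _
    _ ≤ ∑ _Z : HubbardIdx (fermionTorusDiagGraph L), 2 * |t'| :=
        Finset.sum_le_sum fun Z _ => (norm_hubbardTermOp_le _ t' 0 0 Z).trans (by rw [abs_zero]; linarith)
    _ = (Fintype.card (HubbardIdx (fermionTorusDiagGraph L)) : ℝ) * (2 * |t'|) := by
        rw [Finset.sum_const, nsmul_eq_mul, Finset.card_univ]
    _ ≤ (5 * (L : ℝ) ^ 2) * (2 * |t'|) := mul_le_mul_of_nonneg_right hcard (by positivity)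
    _ = 10 * |t'| * (L : ℝ) ^ 2 := by ring

/-- **Flux-uniform norm bound** `‖H_L(θ)‖ ≤ (18 + 10|U| + 26|t′|)·L²` for the seam-flux `t–t′` Hubbard torus
`hubbardTorusTT'Flux L t′ U θ = H_{1,U} + H′_{t′} + (seam twist) + t′·(diagonal seam twist)`. -/
theorem norm_hubbardTorusTT'Flux_le (t' U θ : ℝ) :
    ‖hubbardTorusTT'Flux L t' U θ‖ ≤ (18 + 10 * |U| + 26 * |t'|) * (L : ℝ) ^ 2 := by
  have hL1 : (1 : ℝ) ≤ L := by exact_mod_cast Nat.one_le_iff_ne_zero.mpr (NeZero.ne L)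
  have hLL : (L : ℝ) ≤ (L : ℝ) ^ 2 := by nlinarith
  rw [hubbardTorusTT'Flux_eq, hubbardTorusTT']
  calc _ ≤ ‖hamiltonian (fermionTorusGraph 2 L) 1 U + hamiltonian (fermionTorusDiagGraph L) t' 0‖ +
          ‖seamTwist L θ + (t' : ℂ) • diagSeamTwist L θ‖ := norm_add_le _ _
    _ ≤ (‖hamiltonian (fermionTorusGraph 2 L) 1 U‖ + ‖hamiltonian (fermionTorusDiagGraph L) t' 0‖) +
          (‖seamTwist L θ‖ + ‖(t' : ℂ) • diagSeamTwist L θ‖) := add_le_add (norm_add_le _ _) (norm_add_le _ _)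
    _ ≤ (10 * (1 + |U|) * (L : ℝ) ^ 2 + 10 * |t'| * (L : ℝ) ^ 2) + (8 * L + |t'| * (16 * (L : ℝ) ^ 2)) := by
        gcongr
        · exact norm_hamiltonian_fermionTorusGraph_le U
        · exact norm_hamiltonian_fermionTorusDiagGraph_le t'
        · exact norm_seamTwist_le θ
        · rw [norm_smul, Complex.norm_real, Real.norm_eq_abs]
          exact mul_le_mul_of_nonneg_left (norm_diagSeamTwist_le θ) (abs_nonneg _)
    _ ≤ (18 + 10 * |U| + 26 * |t'|) * (L : ℝ) ^ 2 := by nlinarith [abs_nonneg U, abs_nonneg t']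

/-- **Sector eigenvalue bound**: every eigenvalue of every coordinate-sector block of `H_L(θ)` is at most
`(18 + 10|U| + 26|t′|)·L²` in absolute value, uniformly in the flux (generic in the decidability instances of the sector). -/
theorem abs_eigenvalues_sectorBlock_le (t' U θ : ℝ) (q : Finset (Orb (FermionTorus 2 L)) → Prop) [DecidablePred q]
    [DecidableEq {a // q a}] (hB : ((hubbardTorusTT'Flux L t' U θ).toBlock q q).IsHermitian) (i : {a // q a}) :
    |hB.eigenvalues i| ≤ (18 + 10 * |U| + 26 * |t'|) * (L : ℝ) ^ 2 :=
  (abs_eigenvalues_toBlock_le_norm q hB i).trans (norm_hubbardTorusTT'Flux_le t' U θ)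

omit [NeZero L] in
/-- **Sector dimensions**: a coordinate sector of the torus Fock space has dimension `≤ 4^{L²} ≤ e^{2L²}` (generic in the `Fintype`
instance of the sector). -/
theorem card_sector_le_exp (q : Finset (Orb (FermionTorus 2 L)) → Prop) [Fintype {a // q a}] :
    (Fintype.card {a // q a} : ℝ) ≤ Real.exp (2 * (L : ℝ) ^ 2) := by
  have h1 : Fintype.card {a // q a} ≤ Fintype.card (Finset (Orb (FermionTorus 2 L))) :=
    Fintype.card_le_of_injective Subtype.val Subtype.val_injective
  have h2 : Fintype.card (Finset (Orb (FermionTorus 2 L))) = 2 ^ (2 * L ^ 2) := by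
    rw [Fintype.card_finset]
    congr 1
    rw [show Fintype.card (Orb (FermionTorus 2 L)) = Fintype.card (FermionTorus 2 L × Fin 2) from Fintype.card_congr (Equiv.refl _),
      Fintype.card_prod, Fintype.card_fin, show Fintype.card (FermionTorus 2 L) = L ^ 2 from by
        change Fintype.card (Fin 2 → Fin L) = L ^ 2; rw [Fintype.card_fun, Fintype.card_fin, Fintype.card_fin]]
    ring
  calc (Fintype.card {a // q a} : ℝ) ≤ (2 : ℝ) ^ (2 * L ^ 2) := by exact_mod_cast h2 ▸ h1
    _ ≤ Real.exp 1 ^ (2 * L ^ 2) := by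
        gcongr
        have := Real.add_one_le_exp (1 : ℝ)
        linarith
    _ = Real.exp (2 * (L : ℝ) ^ 2) := by rw [← Real.exp_nat_mul]; push_cast; ring_nf

end Model

end Summit.Ventures.CertifiedManyBodySolver.Theorems.TcThermcert1.ZeroFreeCorridor
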